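import Mathlib.Tactic.Linarith
import Mathlib.Tactic.NormNum
import Mathlib.Tactic.Ring
import Mathlib.Tactic.LinearCombination
import Mathlib.Tactic.Positivity
import Mathlib.Algebra.Group.Basic
import HarnessLib

/-!
# The (0,1) cell of the ι-window, XXV-B: the product ground `B₁ × B₂`, XII (ADDENDUM 1) — the no-limit theorem and KL rank 2 in
# codimension one (report [XXV] §14): arithmetic shadows

Family `hodge`, b2b cell `hweil` (helper of item stmt-HodgeConjecture-2524). Companion (`pg12a_*`) of
`WeilTypeLadderH2ProductGroundTwelve.lean` (same seat). Report `run/shared/lean/b2b/hodge-weil/b2b-hweil-pv1-g37/H2-ZERO-ONE-25.md` ([XXV]) §14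
(ADDENDUM 1). HONEST FRAMING: census results inside the ladder's H2 test ((0,1) cell) on the SPECIAL fourfold `X₀ = B₁ × B₂`; nothing here is
a rung; no case of the Hodge conjecture is proved; no statement of [Markman 2025] / [Perry 2026] / [EdGFS 2025] is used. Conventions as in
the companion.
-/

-- mandated namespace `Summit.HodgeConjecture.HodgeConjecture.…` (Problem = Summit) trips `linter.dupNamespace`; the lakefile disables it
-- tree-wide (weak option), restated here so stand-alone elaboration is warning-free too.
set_option linter.dupNamespace false

namespace Summit.HodgeConjecture.HodgeConjecture.WeilTypeLadder

section ProductGroundTwelveAdd1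

/-- **THEOREM NL ([XXV] 14.1), the dimension bookkeeping.** Near a (0,1) object the moduli space of ι-invariant simple sheaves with
`(ch,t) = (v,0)` is a smooth CURVE (dimension `1`); a family whose image has dimension `d ≥ 2` cannot have a non-empty open part inside a
curve: `d ≤ 1` contradicts `2 ≤ d`. Also the effective virtual dimension `e₁^ι − (e₂^ι − 12) = 2 − e₁^ι` of [XXV] 14.1 REMARK (i)
(`e₂^ι = 10 + 2e₁^ι`). [`omega`] -/
theorem pg12a_no_limit :
    (∀ d : ℕ, 2 ≤ d → ¬ d ≤ 1) ∧
    (∀ e1 e2 : ℤ, e2 = 10 + 2 * e1 → e1 - (e2 - 12) = 2 - e1) := by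
  refine ⟨?_, ?_⟩
  · intro d hd h; omega
  · intro e1 e2 h; omega

/-- **PROPOSITION ST1 (a) ([XXV] 14.4): nineteen loops generate.** In any group, if `g₁ ⋯ g₂₀ = 1` (the relation of `π₁(ℙ¹ ∖ 20 points)`)
then the last loop is a word in the other nineteen: here in the abstract form `a * b = 1 → b = a⁻¹` (with `a` the product of the first
nineteen). [`eq_inv_of_mul_eq_one_right`] -/
theorem pg12a_nineteen_loops {Γ : Type*} [Group Γ] : ∀ a b : Γ, a * b = 1 → b = a⁻¹ := by
  intro a b h
  exact eq_inv_of_mul_eq_one_right h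

/-- **PROPOSITION ST1 (c) ([XXV] 14.4): the local index at the forced half-period via equivariant Hilbert series.** For a graded module
`M` over `ℂ[u,v,u′,v′]` with ι = −1 on the generators, `Σ(−1)^i tr(ι | Torᵢ(M,k)) = 16 · H_M(−1)`. Shadows (with `H(−1)` computed from the
closed forms, denominators cleared): the point `H = 1` gives `16`; the cone `uv = u′v′`, `H = (1−t²)/(1−t)⁴`, gives `0` (numerator `1 − 1`);
the four coordinate axes, `H = (1+3t)/(1−t)`, give `16 · (1−3)/2 = −16` — so `t_x(𝓘_Z 𝓛) = 0 − (−16) = 16 ≠ 0`, UNBALANCED; two axes,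
`H = (1+t)/(1−t)`, give `0` — balanced. [`norm_num`] -/
theorem pg12a_local_index_axes :
    (16 : ℤ) * 1 = 16 ∧ (1 : ℤ) - (-1) ^ 2 = 0 ∧
    (16 : ℤ) * (1 + 3 * (-1)) = (-16) * (1 - (-1)) ∧ (0 : ℤ) - (-16) = 16 ∧ (16 : ℤ) ≠ 0 ∧
    (16 : ℤ) * (1 + (-1)) = 0 * (1 - (-1)) := by
  norm_num

/-- **PROPOSITION TT (b)–(c) ([XXV] 14.5): the budget with the new class `G`.** With `a₁ + a₂ + c = 3` (ch₂, `[G] = 2θ₁θ₂`), `Sh1 = 6 −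
4a₂` and the layer term `−2c(c−1)`, the horizontal cosupport class is `β = 2a₂² − 6a₂ + 8 − 2c² − Sh2`; writing `Σy = 3 − 2a₂`, `Σy² =
Sh2/2` for the four pair values, Cauchy–Schwarz `4Σy² ≥ (Σy)²` gives `4c² + 2β ≤ 7`, so (i) `β ≥ 0 ⟹ c ∈ {−1,0,1}`,
(ii) `c = ±1 ⟹ β = 0` given `4 ∣ β` (the parity: for odd `c`, `β ≡ 0 mod 4`), (iii) several classes `G_i`: `Σcᵢ² ≤ 1`. [`nlinarith`/`omega`] -/
theorem pg12a_tt_budget :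
    (∀ a1 a2 c Sh1 : ℤ, a1 + a2 + c = 3 → Sh1 = 6 - 4 * a2 →
        2 * a1 + 2 * (a2 - 2) ^ 2 - Sh1 - 2 * c * (c - 1) = 2 * a2 ^ 2 - 6 * a2 + 8 - 2 * c ^ 2) ∧
    (∀ a2 c β y1 y2 y3 y4 : ℤ, y1 + y2 + y3 + y4 = 3 - 2 * a2 →
        2 * (y1 ^ 2 + y2 ^ 2 + y3 ^ 2 + y4 ^ 2) = 2 * a2 ^ 2 - 6 * a2 + 8 - 2 * c ^ 2 - β → 0 ≤ β →
        4 * c ^ 2 + 2 * β ≤ 7) ∧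
    (∀ c β : ℤ, 4 * c ^ 2 + 2 * β ≤ 7 → 0 ≤ β → -1 ≤ c ∧ c ≤ 1) ∧
    (∀ c β : ℤ, 4 * c ^ 2 + 2 * β ≤ 7 → 0 ≤ β → (c = 1 ∨ c = -1) → (∃ k : ℤ, β = 4 * k) → β = 0) ∧
    (∀ c1 c2 β : ℤ, 4 * (c1 ^ 2 + c2 ^ 2) + 2 * β ≤ 7 → 0 ≤ β → c1 ≠ 0 → c2 = 0) := by
  refine ⟨?_, ?_, ?_, ?_, ?_⟩
  · intro a1 a2 c Sh1 h1 h2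
    have ha1 : a1 = 3 - c - a2 := by linarith
    rw [ha1, h2]; ring
  · intro a2 c β y1 y2 y3 y4 hs hq hb
    have hid : 4 * (y1 ^ 2 + y2 ^ 2 + y3 ^ 2 + y4 ^ 2) - (y1 + y2 + y3 + y4) ^ 2
        = (y1 - y2) ^ 2 + (y1 - y3) ^ 2 + (y1 - y4) ^ 2 + (y2 - y3) ^ 2 + (y2 - y4) ^ 2 + (y3 - y4) ^ 2 := by ring
    have hnn : 0 ≤ (y1 - y2) ^ 2 + (y1 - y3) ^ 2 + (y1 - y4) ^ 2 + (y2 - y3) ^ 2 + (y2 - y4) ^ 2 + (y3 - y4) ^ 2 := by positivity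
    rw [hs] at hid
    nlinarith [hid, hnn, hq]
  · intro c β h hb
    constructor
    · nlinarith [sq_nonneg (c + 1)]
    · nlinarith [sq_nonneg (c - 1)]
  · intro c β h hb hc hk
    obtain ⟨k, rfl⟩ := hk
    rcases hc with rfl | rfl <;> omega
  · intro c1 c2 β h hb hc1
    have h1 : 1 ≤ c1 ^ 2 := by
      rcases lt_or_gt_of_ne hc1 with hlt | hgt <;> nlinarith
    nlinarith [sq_nonneg c2, h1]

/-- **PROPOSITION TT (d)–(g) ([XXV] 14.5): the new row's numbers.** Degrees: `W̃·Θ̃_a = 2a₁ + Σxᵢ = 3` (both sides, since `Σxᵢ = 3 − 2a₁`);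
`N_{P̂/Σ̂} ≡ −2F₁ − 2F₂ + ΣC_j` (`Θ̃_a² = 2 − 4 = −2`; `μ·(−1) = −1 ⟹ μ = 1`); `(Ŵ + cĜ)|_{P̂} ≡ (3 − 2c)(F₁+F₂) + 2cΣC_j`, degree `−2c` on `C_j`;
for `c = 1`: bidegree `d = 1`, `ch₃`-shift `d − 1 = 0` per ruling, per-component `ch₄ = (d−1)² − 4·C(2,2) = −4`, curve term `χ(𝒪_{ℙ¹}(−2)) =
−1` (×4), layer `ch₄ = 2·(−4) − 4·(−1) = −4`; new-ODP `R¹` lengths `4 · C(3,3) = 4`; Künneth part `2(a₁+a₂) − 4 = 0` for `a₁ + a₂ = 2`;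
so `ch₄(𝓛′) = 0 − 4 + 4 + Σ_old = Σ_old` and the colength is `c₀′ = Σ_old + 2 ∈ {2, 4}` for `Σ_old ∈ {0, 2}`; the general layer sum
`Σ_{c′=1}^{c} (4 − 4c′) = −2c(c−1)` at `c = 1, 2, 3`. [`norm_num` / `omega`] -/
theorem pg12a_tt_row :
    (∀ a1 : ℤ, 2 * a1 + (3 - 2 * a1) = 3) ∧ ((2:ℤ) - 4 = -2) ∧ (∀ μ : ℤ, μ * (-1) = -1 → μ = 1) ∧
    (∀ c : ℤ, (3 - 2 * c) * 0 + 2 * c * (-1) = -2 * c) ∧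
    ((3:ℤ) - 2 * 1 = 1 ∧ (1:ℤ) - 1 = 0 ∧ ((1:ℤ) - 1) ^ 2 - 4 * 1 = -4 ∧ (2:ℤ) * (-4) - 4 * (-1) = -4 ∧ (4:ℤ) * 1 = 4) ∧
    (∀ a1 a2 : ℤ, a1 + a2 = 2 → a1 * a2 - (a1 - 2) * (a2 - 2) = 0) ∧
    (∀ S : ℤ, 0 - 4 + 4 + S = S ∧ (S = 0 ∨ S = 2 → S + 2 = 2 ∨ S + 2 = 4)) ∧
    ((4:ℤ) - 4 * 1 = -2 * 1 * (1 - 1) ∧ (4 - 4 * 1) + (4 - 4 * 2) = -2 * 2 * ((2:ℤ) - 1) ∧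
      (4 - 4 * 1) + (4 - 4 * 2) + (4 - 4 * 3) = -2 * 3 * ((3:ℤ) - 1)) := by
  refine ⟨fun a1 => by ring, by norm_num, fun μ h => by linarith, fun c => by ring, by norm_num, ?_, ?_, by norm_num⟩
  · intro a1 a2 h
    linear_combination (2:ℤ) * h
  · intro S
    refine ⟨by ring, ?_⟩
    intro h
    omega

end ProductGroundTwelveAdd1

end Summit.HodgeConjecture.HodgeConjecture.WeilTypeLadder
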